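/-
Copyright: statement-level skeleton of a published paper (lit-balaban cell, Phase-2 proof seat p25, gen 22). No proof
claims beyond what the kernel checks below.
-/
import Literature.MathematicalPhysics.QuantumFieldTheory.BalabanImbrieJaffe1984to88.BIJ88WalkIneq312Split245
import Literature.MathematicalPhysics.QuantumFieldTheory.BalabanImbrieJaffe1984to88.BIJ88Decay241Walks
import Literature.MathematicalPhysics.QuantumFieldTheory.BalabanImbrieJaffe1984to88.BIJ88WalkIneq312NonVacuity

/-!
# `BalabanImbrieJaffe1984to88.BIJ88WalkIneq312Split245Walks` — T. Bałaban, J. Imbrie, A. Jaffe, *Effective action and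
cluster properties of the abelian Higgs model*, Commun. Math. Phys. **114** (1988) 257–315 [BalabanImbrieJaffe1988],
§5.14 p. 312 [PDF 56], verbatim: *"These considerations lead to the following estimate: |G_k(X)| ≤
c(F(X))(e^β(L^kε/ε₀)^{1/4−α})^{β′|X∖∪_cX_c|} × Π_{X_{σ_1} ⊂ X : dist(X_{σ_1}, Λ₁₂^{(k)c}) < r(e_k)} [c(L^kε)^{−m(c)}e^{−m′(c)}]."*,
p. 310 [PDF 54]: *"We give random walk expansions for the propagators … The others, localized in region X, have a
factor of e^{−cr(e_k)|X|}."* and Sect. 2 p. 264 [PDF 8]: *"by (2.38), C^{(k)}_Λ(u)^{−1} is bounded below and a random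
walk expansion as in [6] can be used to prove that |C^{(k)}_Λ(u; x₁, x₂)| ≦ ce^{−c|x₁−x₂|}. (2.41) … The local part
C^{(k)}_{Λ,loc}(u; x₁, x₂) … is bounded as in (2.41). … |C^{(k)}_{Λ,X}(u; x₁, x₂)| ≦ e^{−cr(e_k)|X|}. (2.46)"* ([6] =
T. Bałaban, *Regularity and decay of lattice Green's functions*, CMP **89** (1983) [Balaban1983RegularityDecay]) —
**THE HEAD THEOREM OF ROW C2.Claim@312 ON PRINT'S SPLIT (2.45) IN THE SETTING OF [6]** (p25 gen 22; file W6c, a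
MEMBER of the row, owner r16, referee ref-5; the head of record `BIJ88WalkIneq312RemainderBdry.ineq312_remainder_bdry`
and every earlier file UNCHANGED).

W6b (`BIJ88WalkIneq312Split245.ineq312_remainder_bdry_split245`) takes the typed row (2.46) and an entrywise letter
on `C_loc` as HYPOTHESES.  Both are PROVED in the tree in the setting of [6] — p36's `BIJ88Ineq246Walks.ineq246`
((2.46) with the explicit rate `c = δ/(32K²M)`, under *"r(e_k) large"*: `s₀A/(1 − Dβ) ≤ e^{δs/(32K²)}`) and p02's
`BIJ88Decay241Walks.abs_cLoc_le_exp` (*"bounded as in (2.41)"*: `|C_loc(x₁,x₂)| ≤ (s₀A/(1 − Dβ))e^{2δb₀/μ}e^{−(δ/μ)|x₁−x₂|}`).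
Here the two are DISCHARGED BY NAME: `ineq312_remainder_bdry_split245_walks` = the head of the row on print's split
with, in place of the row and the letter, [6]'s hypotheses as typed by p36/p02 — walk kernels `C_ω` majorized by
`A·βⁿ` with END-POINT LOCALITY on nearest-neighbour walks of out-degree `≤ D_w`, `D_wβ ≤ e^{−δ}`, at most `s₀` blocks
per site, the label/cube/site geometry (`d`, `touch`, `s`, `μ`, `b₀`, `s/8 ≤ (ρ − b₀)/μ`), `r(e_k) ≤ M_w·s`, and the
largeness `s₀A/(1 − D_wβ) ≤ e^{δs/(32K²)}`; `c := δ/(32K²M_w)`, `E_loc := (s₀A/(1 − D_wβ))e^{2δb₀/μ}`.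

statement-level skeleton of published theorems with citation tags; proofs where landed; nothing here is a claim
about the Yang–Mills mass gap

PDF held: `paper:balaban1988-cmp114-bij-abelian-higgs-effective-action` (journal page = PDF page + 256); p. 312 =
PDF 56, p. 310 = PDF 54, p. 264 = PDF 8.

CITATION HEADER (lean-in-tree rule).  lit-balaban cell (HOME `run/shared/lean/pub/lit-balaban/`), Phase 2, seat p25
gen 22; row **C2.Claim@312** of `HOME/lit-balaban-r16/ROWS-C2-part2.md` (owner r16, referee ref-5; MEMBER); reader
edges to rows C2.Eq2.41, C2.Eq2.46 (owner r18).  USED BY NAME, nothing restated: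
`BIJ88WalkIneq312Split245.ineq312_remainder_bdry_split245` (W6b), `BIJ88Ineq246Walks.ineq246` (p36),
`BIJ88Decay241Walks.abs_cLoc_le_exp` (p02), p13's `BIJ88RandomWalk242` carriers, the §5.13 model of record.

## What is proved (0 `sorry`, standard axioms, no new `Prop` facts; one theorem, no definitions)

* **`ineq312_remainder_bdry_split245_walks`**.
HONEST SCOPE: (a) as W6b, with (2.46) and the `C_loc` letter now PROVED from [6]'s hypotheses (p36/p02's «model
instance»: the majorant `A·βⁿ` with end-point locality = [6] Lemma 2.1 for the actual `C^{(k)}_Λ(u)` of (2.40), i.e.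
the L²-bounds behind it and the lower bound (2.38), remain HYPOTHESES — no operator is constructed); (b) the site
distance is assumed nonnegative (`hsd0`) so that the (2.41) profile is bounded by its prefactor.  NOT summit progress;
NOT continuum; NOT Clay.  Imports `BIJ88WalkIneq312Split245`, `BIJ88Decay241Walks`; modifies nothing.
-/

noncomputable section

namespace Literature.MathematicalPhysics.QuantumFieldTheory.BalabanImbrieJaffe1984to88.BIJ88WalkIneq312Split245Walks

open Classical MeasureTheory Matrix Finset
open scoped BigOperators ContDiff
open Literature.MathematicalPhysics.QuantumFieldTheory.Balaban1983to89
open B2Eq228Conditioning (weight source)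
open BIJ88PolymerRep5134 (corner)
open BIJ88PolymerRep5134Gauss (prec src)
open BIJ88VertexIbp311 (vexp)
open BIJ88RandomWalk242
open BIJ88Ineq246Walks (ineq246)
open BIJ88Decay241Walks (abs_cLoc_le_exp)
open BIJ88WalkIneq312Split245 (ineq312_remainder_bdry_split245)
open BIJ88WalkRun311 BIJ88WalkExpansion311 BIJ88WalkExpansionGeo311 BIJ88WalkTermCount312
  BIJ88WalkRemainderActivity312 BIJ88WalkIneq312Remainder
open Literature.Probability.LatticeModels (IsRConnected)

/-! ## §1  The head on print's split in the setting of [6] -/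

section Walks

variable {ι : Type} [Fintype ι] {κ : Type} [LinearOrder κ] {β : Type} [Fintype β] [DecidableEq β]
variable {α I : Type} [Fintype α] [DecidableEq α] [Fintype I] [DecidableEq I]
  {blk : α → I} {Δ : Matrix α α ℝ} {ℱ : α → ℝ} {W : Finset I} {J : Type} [Fintype J] [DecidableEq J]

/-- **THE HEAD THEOREM OF ROW C2.Claim@312 ON PRINT'S SPLIT (2.45), IN THE SETTING OF [6]**: W6b's
`ineq312_remainder_bdry_split245` with the typed row (2.46) DISCHARGED by p36's `BIJ88Ineq246Walks.ineq246`
(`c := δ/(32K²M_w)`) and the `C_loc` letter DISCHARGED by p02's `BIJ88Decay241Walks.abs_cLoc_le_exp`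
(`E_loc := (s₀A/(1 − D_wβ))e^{2δb₀/μ}`), i.e. under [6]'s hypotheses: walk kernels `|C_ω(x₁,x₂)| ≤ A·β^{|ω|}`
vanishing unless `ω` is a nearest-neighbour walk from a block of `x₁` to a block of `x₂`, out-degree `≤ D_w`,
`D_wβ ≤ e^{−δ}`, `≤ s₀` blocks per site (walks written `γ` here: `ω` is notation in the `ContDiff` scope), label distance `d` (`≤ 1` across adjacent labels), touching cubes (degree
`≤ K`, non-touching cubes `≥ s` apart), `ldist` `μ`-Lipschitz with blocks of radius `b₀`, `s/8 ≤ (ρ − b₀)/μ`,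
`r(e_k) ≤ M_w·s`, `s₀A/(1 − D_wβ) ≤ e^{δs/(32K²)}`, nonnegative site distance; all other clauses as in W6b.
[cite: BalabanImbrieJaffe1988, §5.14 p.312 (estimate preceding (5.14.5)); p.310; (2.41), (2.43)-(2.46) p.264; (5.2.1)-(5.2.4) p.278] -/
theorem ineq312_remainder_bdry_split245_walks (hPD : (prec blk Δ W (corner ℝ W)).PosDef)
    (adj : J → J → Prop) [DecidableRel adj] (ldist : J → {x : α // blk x ∈ W} → ℝ) (ρr : ℝ) (cubeOf : J → β)
    (cadj : β → β → Prop) [DecidableRel cadj] (Cw : Walk J → {x : α // blk x ∈ W} → {x : α // blk x ∈ W} → ℝ)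
    (inBlock : {x : α // blk x ∈ W} → J → Prop) (cube : {x : α // blk x ∈ W} → β)
    -- [6]'s setting (p36/p02's typing)
    (d : J → J → ℝ) (hd0 : ∀ i, d i i = 0) (hdsymm : ∀ i l, d i l = d l i)
    (htrid : ∀ i j l, d i l ≤ d i j + d j l) (hadj : ∀ i l, adj i l → d i l ≤ 1)
    (touch : β → β → Prop) [DecidableRel touch] (hrefl : ∀ c, touch c c)
    (htsymm : ∀ c c', touch c c' → touch c' c) {K : ℕ}
    (hK : ∀ (c : β) (Y : Finset β), (Y.filter fun c' => touch c c').card ≤ K)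
    (hKc : ∀ c : β, (Finset.univ.filter fun c' => c = c' ∨ cadj c c').card ≤ K)
    {s : ℕ} (hfar : ∀ i l, ¬ touch (cubeOf i) (cubeOf l) → (s : ℝ) ≤ d i l)
    {μ b₀ : ℝ} (hμ : 0 < μ) (hld : ∀ (i l : J) (x : {x : α // blk x ∈ W}), ldist l x ≤ ldist i x + μ * d i l)
    (hb : ∀ (x : {x : α // blk x ∈ W}) (i : J), inBlock x i → ldist i x ≤ b₀) (hρ8 : (s : ℝ) / 8 ≤ (ρr - b₀) / μ)
    {A βw δ : ℝ} {Dw s₀ : ℕ} (hA : 0 ≤ A) (hβ0 : 0 ≤ βw)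
    (hDw : ∀ j, (Finset.univ.filter fun i => adj j i).card ≤ Dw) (hδ : 0 < δ)
    (hDβ : (Dw : ℝ) * βw ≤ Real.exp (-δ))
    (hmaj : ∀ γ x₁ x₂, |Cw γ x₁ x₂| ≤ A * βw ^ γ.len)
    (hnz : ∀ γ x₁ x₂, Cw γ x₁ x₂ ≠ 0 → γ.IsNN adj ∧ inBlock x₁ γ.start ∧ inBlock x₂ γ.last)
    (hS₀ : ∀ x, ∃ S₀ : Finset J, S₀.card ≤ s₀ ∧ ∀ i, inBlock x i → i ∈ S₀)
    {Mw rek : ℝ} (hMw : 0 < Mw) (hs : rek ≤ Mw * s)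
    (hlarge : s₀ * A / (1 - Dw * βw) ≤ Real.exp (δ * s / (32 * K * K)))
    {c : ℝ} (hc : c = δ / (32 * K * K * Mw))
    {Eloc : ℝ} (hE : Eloc = s₀ * A / (1 - Dw * βw) * Real.exp (2 * δ * b₀ / μ))
    -- the remaining geometry, as in W6b
    (hblk : ∀ x j, inBlock x j → cube x ∈ closure cadj {cubeOf j})
    (sdist : {x : α // blk x ∈ W} → {x : α // blk x ∈ W} → ℝ) (hsd0 : ∀ x₁ x₂, 0 ≤ sdist x₁ x₂)
    (htri : ∀ j x₁ x₂, sdist x₁ x₂ ≤ ldist j x₁ + ldist j x₂) (near : β → β → Prop)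
    (hnear : ∀ x₁ x₂, sdist x₁ x₂ ≤ 2 * ρr → near (cube x₂) (cube x₁)) {D sc : ℕ}
    (hD : ∀ k, (univ.filter fun k' => near k k').card ≤ D)
    (hsc : ∀ k, (univ.filter fun x => cube x = k).card ≤ sc)
    (Rk : β → β → Prop) (hRk : ∀ x y, Rk x y → Rk y x) {nbr : β → Finset β} {Δc : ℕ}
    (hΔc : ∀ x, (nbr x).card ≤ Δc) (hnbr : ∀ x y, Rk x y → y ∈ nbr x)
    (hsmall : ((Δc : ℝ) + 1) ^ 2 * (Real.exp 1 * Real.exp (-(c * rek / 2))) ≤ 1 / 2)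
    {Rinf R1 : ℝ} (hRinf : 0 ≤ Rinf) (hR1 : 0 ≤ R1)
    {cv : ι → ℝ} {legs : ι → List ({x : α // blk x ∈ W} → ℝ)} {obs : κ → List ({x : α // blk x ∈ W} → ℝ)} {M : ℕ}
    {oc : κ → Finset β} {vc : ι → Finset β} {cV : ι → ℝ} {Bl θ θv θw : ℝ} {legCube : ι → ℕ → β} {L : ℕ}
    {B : Type} (Bs : Finset B) {y : B → {x : α // blk x ∈ W}} (hy : Set.InjOn y Bs)
    {g : ℝ → ℝ} (hg : ContDiff ℝ ∞ g) {cg : ℝ}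
    (hgc : ∀ (n : ℕ) (x : ℝ), |iteratedDeriv n g x| ≤ cg ^ n * (n : ℝ) ^ (cg * n))
    {KV p μs vs : ℝ} (hV : ∀ φ, |vexp cv legs φ| ≤ KV) (hp1 : 1 ≤ p) (hμs : 0 ≤ μs) (hvs : 0 ≤ vs)
    (hobsm : ∀ j, ∀ w ∈ obs j, |w ⬝ᵥ ((prec blk Δ W (corner ℝ W))⁻¹ *ᵥ src blk ℱ W)| ≤ μs ∧
      w ⬝ᵥ ((prec blk Δ W (corner ℝ W))⁻¹ *ᵥ w) ≤ vs)
    (hlegsm : ∀ m, ∀ w ∈ legs m, |w ⬝ᵥ ((prec blk Δ W (corner ℝ W))⁻¹ *ᵥ src blk ℱ W)| ≤ μs ∧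
      w ⬝ᵥ ((prec blk Δ W (corner ℝ W))⁻¹ *ᵥ w) ≤ vs)
    (hθ0 : 0 < θ) (hθ1 : θ ≤ 1) (hBl : 1 ≤ Bl) (hcV0 : ∀ m, 0 ≤ cV m)
    (hθv : 0 < θv) (hθv1 : θv ≤ 1) (hθw : 0 < θw) (hθw1 : θw ≤ 1) (hcV : ∀ m, |cv m| ≤ cV m)
    (hobs : ∀ j, ∀ w ∈ obs j, (∃ k, ∀ z, w z ≠ 0 → cube z = k) ∧ ‖w‖ ≤ Rinf ∧ ∑ x, |w x| ≤ R1)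
    (hlegs : ∀ m, ∀ w ∈ legs m, (∃ k, ∀ z, w z ≠ 0 → cube z = k) ∧ ‖w‖ ≤ Rinf ∧ ∑ x, |w x| ≤ R1)
    (hvert : ∀ m, cV m * Bl ^ (legs m).length ≤ θv * θ ^ (vc m).card)
    (hleg : ∀ m j x, ((legs m).getD j 0) x ≠ 0 → cube x = legCube m j)
    (hL : ∀ k, (∑ m, ((range (legs m).length).filter fun j => legCube m j = k).card) ≤ L)
    (h4 : 4 ≤ c * rek) (hθrek : Real.exp (-(c * rek / 4)) ≤ θ)
    (hBl' : Eloc * ((D * sc : ℕ) : ℝ) * (R1 * (Rinf + ‖src blk ℱ W‖ + 1)) ≤ Bl)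
    (hθw' : Real.exp (-(c * rek / 4)) * sc * (R1 * (Rinf + ‖src blk ℱ W‖ + 1)) ≤ θw)
    (bdry : Finset κ)
    (hbeat : ∀ O : Finset κ, ∀ t ∈ expand (fun p : Option {X : Finset β // IsRConnected Rk X} =>
        (Option.elim p (cLoc ldist ρr Cw) fun r => cX ldist ρr cubeOf cadj Cw r.1 :
          Matrix {x : α // blk x ∈ W} {x : α // blk x ∈ W} ℝ)) (fun p => Option.isSome p) (src blk ℱ W) cv legs obs
        M 0 O, t.consts = 0 → ∀ X ∈ t.groups,
      max p⁻¹ (max (θv ^ M) θw) * ∏ j ∈ X.lab.filter (fun j => j ∉ bdry), Bl ^ (obs j).length ≤ 1) :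
    BIJ88Sect5StatementsPart4.Ineq312 (remSys κ β)
      (fun OX => remAt (prec blk Δ W (corner ℝ W)) (fun p : Option {X : Finset β // IsRConnected Rk X} =>
          (Option.elim p (cLoc ldist ρr Cw) fun r => cX ldist ρr cubeOf cadj Cw r.1 :
            Matrix {x : α // blk x ∈ W} {x : α // blk x ∈ W} ℝ)) (fun p => Option.isSome p) (src blk ℱ W) cv legs obs M
        (fun ψ => ∏ b ∈ Bs, g (p⁻¹ * (ContinuousLinearMap.proj (y b) : ({x : α // blk x ∈ W} → ℝ) →L[ℝ] ℝ) ψ))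
        oc vc (fun p => Option.elim p (∅ : Finset β) fun r => r.1) [] 0 OX.1 OX.2
        / ∫ φ, weight (prec blk Δ W (corner ℝ W)) φ * source (src blk ℱ W) φ)
      (fun OX => KV * ((max 1 (max 1 cg * (max 1 (phi0 legs obs M OX.1 : ℝ)) ^ cg)) ^ phi0 legs obs M OX.1
            * ∑ N ∈ range (phi0 legs obs M OX.1 + 1), 2 ^ N * (μs ^ N + (1 + vs ^ N * ((2 * N - 1).doubleFactorial : ℝ))))
          * (max 1 (2 * (phi0 legs obs M OX.1 : ℝ) + L * ((D : ℝ) + 1))) ^ phi0 legs obs M OX.1)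
      (fun OX => ∏ j ∈ OX.1.filter (fun j => j ∈ bdry), Bl ^ (obs j).length)
      (fun OX => nfreeOf oc OX.2) θ 1 := by
  -- (2.46) PROVED in [6]'s setting (p36), with the rate `c = δ/(32K²M_w)`
  have h246 : BIJ88Sect2Statements.Ineq246 (fun X : Finset β => X.card) (memX inBlock cubeOf cadj)
      (cX ldist ρr cubeOf cadj Cw) c rek := by
    rw [hc]
    exact ineq246 adj ldist ρr cubeOf cadj Cw inBlock d hd0 hdsymm htrid hadj touch hrefl htsymm hK hKc hfar hμ hld hb
      hρ8 hA hβ0 hDw hδ hDβ hmaj hnz hS₀ hMw hs hlarge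
  -- the `C_loc` letter PROVED in [6]'s setting (p02): the (2.41) profile is bounded by its prefactor
  have hθlt : (Dw : ℝ) * βw < 1 := hDβ.trans_lt (Real.exp_lt_one_iff.mpr (neg_lt_zero.mpr hδ))
  have hpref : 0 ≤ s₀ * A / (1 - Dw * βw) * Real.exp (2 * δ * b₀ / μ) :=
    mul_nonneg (div_nonneg (mul_nonneg (Nat.cast_nonneg _) hA) (by linarith)) (Real.exp_pos _).le
  have hE0 : 0 ≤ Eloc := hE ▸ hpref
  have hEloc : ∀ x₁ x₂, |cLoc ldist ρr Cw x₁ x₂| ≤ Eloc := fun x₁ x₂ => by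
    refine (abs_cLoc_le_exp adj ldist ρr Cw inBlock d hd0 hdsymm htrid hadj hμ hld hb sdist htri hA hβ0 hDw hδ hDβ
      hmaj hnz hS₀ x₁ x₂).trans ?_
    rw [hE]
    refine mul_le_of_le_one_right hpref (Real.exp_le_one_iff.mpr ?_)
    have : 0 ≤ δ / μ * sdist x₁ x₂ := mul_nonneg (div_nonneg hδ.le hμ.le) (hsd0 x₁ x₂)
    linarith
  exact ineq312_remainder_bdry_split245 hPD ldist ρr cubeOf cadj Cw inBlock cube h246 hblk hE0 hEloc sdist htri near
    hnear hD hsc Rk hRk hΔc hnbr hsmall hRinf hR1 Bs hy hg hgc hV hp1 hμs hvs hobsm hlegsm hθ0 hθ1 hBl hcV0 hθv hθv1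
    hθw hθw1 hcV hobs hlegs hvert hleg hL h4 hθrek hBl' hθw' bdry hbeat

end Walks

/-! ## §2  Kernel non-vacuity of the head on print's split -/

section Toy

open BIJ88Sect5Statements (CutoffProfile)
open BIJ88VertexIbp311 (vpoly)
open BIJ88WalkIneq312NonVacuity (toy_prec_posDef)

/-- `e^{−1} ≤ ½` (bookkeeping for the toy's largeness numbers). [folklore] -/
private theorem exp_neg_one_le_half : Real.exp (-1) ≤ 1 / 2 := by
  have he2 : (2 : ℝ) ≤ Real.exp 1 := by linarith [Real.add_one_le_exp (1 : ℝ)]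
  rw [Real.exp_neg, inv_le_comm₀ (Real.exp_pos _) (by norm_num)]
  norm_num
  exact he2

/-- **KERNEL NON-VACUITY OF `ineq312_remainder_bdry_split245`**: every binder of W6b's head-on-the-split is
inhabited and every hypothesis discharged by the kernel on the one-site toy of `BIJ88WalkIneq312NonVacuity` (one
label, one cube, zero walk kernels so `C_loc = C_X = 0`, the row (2.46) and the `C_loc` letter trivial; `c·r(e_k) = 4`,
`λ = e^{−2}`, `(Δ+1)²eλ = e^{−1} ≤ ½`; `s_c = D = R_∞ = R₁ = 1`, `E_loc = 0`, `B_ℓ = θ = θ_v = θ_w = 1`,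
`e^{−1}·s_c·R₁K_w = 2e^{−1} ≤ θ_w`; one observable with the leg `1`, no vertex, site cutoff `χ₁(ψ(site)/1)` for ANY
`χ₁ : CutoffProfile`) — the hypotheses of W6b (largeness numbers included) are jointly satisfiable.  Nothing about
print beyond consistency. [cite: BalabanImbrieJaffe1988, §5.14 p.312 (estimate preceding (5.14.5))] -/
example (χp : CutoffProfile) {cg : ℝ}
    (hgc : ∀ (n : ℕ) (x : ℝ), |iteratedDeriv n χp.χ₁ x| ≤ cg ^ n * (n : ℝ) ^ (cg * n)) :=
  have hsrc : src (fun _ : Unit => ()) (0 : Unit → ℝ) ({()} : Finset Unit) = 0 := by funext x; simp [src]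
  have hcX : ∀ (X : Finset Unit) (x₁ x₂ : {x : Unit // (fun _ : Unit => ()) x ∈ ({()} : Finset Unit)}),
      cX (fun (_ : Unit) (_ : {x : Unit // (fun _ : Unit => ()) x ∈ ({()} : Finset Unit)}) => (0 : ℝ)) 0
        (fun _ : Unit => ()) (fun _ _ : Unit => False) (fun _ _ _ => (0 : ℝ)) X x₁ x₂ = 0 := fun X x₁ x₂ => by
    unfold cX
    exact (tsum_congr fun w => by simp [Set.indicator_apply]).trans tsum_zero
  have hcLoc : ∀ x₁ x₂ : {x : Unit // (fun _ : Unit => ()) x ∈ ({()} : Finset Unit)},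
      cLoc (fun (_ : Unit) (_ : {x : Unit // (fun _ : Unit => ()) x ∈ ({()} : Finset Unit)}) => (0 : ℝ)) 0
        (fun _ _ _ => (0 : ℝ)) x₁ x₂ = 0 := fun x₁ x₂ => by
    unfold cLoc
    exact (tsum_congr fun w => by simp [Set.indicator_apply]).trans tsum_zero
  have hV : ∀ φ : {x : Unit // (fun _ : Unit => ()) x ∈ ({()} : Finset Unit)} → ℝ,
      |vexp (fun _ : Fin 0 => (0 : ℝ)) (fun _ : Fin 0 => []) φ| ≤ 1 := fun φ => by simp [vexp, vpoly]
  have hcard : ((Finset.univ : Finset {x : Unit // (fun _ : Unit => ()) x ∈ ({()} : Finset Unit)}).card : ℝ) ≤ 1 := by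
    exact_mod_cast Finset.card_le_one.2 fun _ _ _ _ => Subsingleton.elim _ _
  ineq312_remainder_bdry_split245 (ι := Fin 0) (κ := Unit) (β := Unit) (J := Unit) toy_prec_posDef
    (fun _ _ => (0 : ℝ)) 0 (fun _ => ()) (fun _ _ => False) (fun _ _ _ => (0 : ℝ)) (fun _ _ => True) (fun _ => ())
    (c := 4) (rek := 1)
    ⟨fun X x₁ x₂ _ => hcX X x₁ x₂, fun X x₁ x₂ => by rw [hcX, abs_zero]; exact (Real.exp_pos _).le⟩
    (fun _ _ _ => subset_closure _ _ (Finset.mem_singleton_self _))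
    (Eloc := 0) le_rfl (fun x₁ x₂ => by rw [hcLoc, abs_zero])
    (fun _ _ => (0 : ℝ)) (fun _ _ _ => by norm_num) (fun _ _ => True) (fun _ _ _ => trivial)
    (D := 1) (sc := 1) (fun _ => Finset.card_le_one.2 fun _ _ _ _ => Subsingleton.elim _ _)
    (fun _ => Finset.card_le_one.2 fun _ _ _ _ => Subsingleton.elim _ _)
    (fun _ _ => False) (fun _ _ h => h.elim) (nbr := fun _ => ∅) (Δc := 0) (fun _ => by simp) (fun _ _ h => h.elim)
    (by
      calc (((0 : ℕ) : ℝ) + 1) ^ 2 * (Real.exp 1 * Real.exp (-(4 * 1 / 2))) = Real.exp (-1) := by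
            rw [← Real.exp_add]; norm_num
        _ ≤ 1 / 2 := exp_neg_one_le_half)
    (Rinf := 1) (R1 := 1) zero_le_one zero_le_one
    (cv := fun _ : Fin 0 => (0 : ℝ)) (legs := fun _ : Fin 0 => [])
    (obs := fun _ : Unit => [fun _ => (1 : ℝ)]) (M := 1) (oc := fun _ : Unit => (∅ : Finset Unit))
    (vc := fun _ : Fin 0 => (∅ : Finset Unit)) (cV := fun _ : Fin 0 => (0 : ℝ)) (Bl := 1) (θ := 1) (θv := 1) (θw := 1)
    (legCube := fun _ _ => ()) (L := 0)
    (Finset.univ : Finset Unit) (y := fun _ : Unit => ⟨(), Finset.mem_singleton_self ()⟩)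
    (fun _ _ _ _ _ => Subsingleton.elim _ _) χp.smooth hgc (KV := 1) (p := 1) (μs := 0)
    (vs := max ((fun _ => (1 : ℝ)) ⬝ᵥ ((prec (fun _ : Unit => ()) (1 : Matrix Unit Unit ℝ) ({()} : Finset Unit)
      (corner ℝ ({()} : Finset Unit)))⁻¹ *ᵥ fun _ => (1 : ℝ))) 0)
    hV le_rfl le_rfl (le_max_right _ _)
    (fun _ w hw => by
      rw [List.mem_singleton] at hw; subst hw
      rw [hsrc, Matrix.mulVec_zero, dotProduct_zero, abs_zero]
      exact ⟨le_rfl, le_max_left _ _⟩)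
    (fun m => m.elim0) one_pos le_rfl le_rfl (fun m => m.elim0) one_pos le_rfl one_pos le_rfl (fun m => m.elim0)
    (fun _ w hw => by
      rw [List.mem_singleton] at hw; subst hw
      refine ⟨⟨(), fun _ _ => rfl⟩, (pi_norm_le_iff_of_nonneg zero_le_one).2 fun _ => by simp, ?_⟩
      calc ∑ x, |(fun _ : {x : Unit // (fun _ : Unit => ()) x ∈ ({()} : Finset Unit)} => (1 : ℝ)) x|
          = ((Finset.univ : Finset {x : Unit // (fun _ : Unit => ()) x ∈ ({()} : Finset Unit)}).card : ℝ) := by simp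
        _ ≤ 1 := hcard)
    (fun m => m.elim0) (fun m => m.elim0) (fun m => m.elim0)
    (fun _ => by simp) (by norm_num) (Real.exp_le_one_iff.mpr (by norm_num)) (by simp)
    (by
      rw [hsrc, norm_zero]
      calc Real.exp (-(4 * 1 / 4)) * ((1 : ℕ) : ℝ) * (1 * (1 + 0 + 1)) = 2 * Real.exp (-1) := by norm_num; ring
        _ ≤ 1 := by linarith [exp_neg_one_le_half])
    ({()} : Finset Unit) (fun O t _ _ X _ => by simp)

end Toy

end Literature.MathematicalPhysics.QuantumFieldTheory.BalabanImbrieJaffe1984to88.BIJ88WalkIneq312Split245Walks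

end
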